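import Mathlib.Analysis.SpecialFunctions.Gamma.Beta
import Mathlib.Analysis.SpecialFunctions.Pow.Real
import Mathlib.MeasureTheory.Integral.IntervalIntegral.Basic
import Mathlib.Tactic
import Literature.Probability.RandomPlanarGeometry.GaussIncompleteBeta
import Summits.CriticalPhenomena.PercolationContinuityZ3.Theorems.PercNearOneGluingNoHeavyLowerTailCoreT
import HarnessLib

/-!
# (Ω₁) at every real rate θ > 0: the Beta-integral mixture of CORE(t)

Support file for the Sahi / Conjecture-P programme of route `PercNearOneGluingNoHeavy`
(`--supports stmt-CriticalPhenomena-4575`, prover prim-l12-p5 gen 29; proof note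
`prim-l12-p5/OMEGA1-g27.md` §1).  No definitions, no named facts, no sorries.

(Ω₁) (= CONJECTURE Ω of `prim-l12-p5/OMEGA-g25.md` §3.2 for the deterministic single-token law) is the
hit-set inequality of `CoreT.core_t` with the biased buffer `ρ^i + ρ^{h-i}` replaced by the rising-factorial
kernel `θ^{(i)} θ^{(h-i)}` (`θ^{(i)} = ∏_{k<i} (θ+k)`, `h = h₁+h₂`):
`(a+c)·S_θ(a+1,c) ≤ (a+c+1)·S_θ(a+1,c+1)`,
`S_θ(α,γ) = ∑_{i,j} C(h₁,i)C(u₁,α-i)C(h₂,j)C(u₂,γ-j)·C(h-2,i+j-1)·θ^{(i+j)}θ^{(h-i-j)}`.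

* `beta_mixture` (the analytic step): if `0 ≤ ∑_i E_i (ρ^{m_i} + ρ^{h-m_i})` for every `ρ > 0` then
  `0 ≤ ∑_i E_i θ^{(m_i)} θ^{(h-m_i)}` for every `θ > 0` — because, by Euler's Beta integral
  (`Literature…GaussIncompleteBeta.integral_betaKernel_eq_Gamma`) and `Γ(θ+m) = θ^{(m)}Γ(θ)`,
  `θ^{(m)}θ^{(h-m)} = [Γ(2θ+h)/(2Γ(θ)²)]·∫₀¹ u^{θ-1}(1-u)^{θ-1}[u^m(1-u)^{h-m} + (1-u)^m u^{h-m}] du` and the bracket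
  is `(1-u)^h (ρ^m + ρ^{h-m})` with `ρ = u/(1-u)`;
* `omega_one` (**(Ω₁) for every real `θ > 0`**): `beta_mixture` applied to `CoreT.core_t`.
With `UAll.u_all ⟹ TestJ.test_j ⟹ CoreRho/CoreT ⟹ omega_one` the whole chain
U ⟹ TEST(j) ⟹ CORE(t) ⟹ (Ω₁) of OMEGA1-g27 is kernel-checked.
-/

namespace Summit.CriticalPhenomena.PercolationContinuityZ3.Theorems

namespace OmegaOne

open Finset MeasureTheory Set

/-- Euler's Beta integral in real form: `∫₀¹ u^{p-1}(1-u)^{q-1} du = Γ(p)Γ(q)/Γ(p+q)` (`p, q > 0`). -/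
theorem beta_real (p q : ℝ) (hp : 0 < p) (hq : 0 < q) :
    ∫ u in (0 : ℝ)..1, u ^ (p - 1) * (1 - u) ^ (q - 1) =
      Real.Gamma p * Real.Gamma q / Real.Gamma (p + q) := by
  have h := Literature.Probability.RandomPlanarGeometry.integral_betaKernel_eq_Gamma
    (α := 1 - q) (β := p) (by linarith) hp
  rw [neg_sub, sub_sub_cancel, show p + 1 - (1 - q) = p + q by ring] at h
  exact h

/-- The Beta kernel `u^{p-1}(1-u)^{q-1}` is integrable on `[0,1]` for `p, q > 0`. -/
theorem beta_integrable (p q : ℝ) (hp : 0 < p) (hq : 0 < q) :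
    IntervalIntegrable (fun u : ℝ => u ^ (p - 1) * (1 - u) ^ (q - 1)) volume 0 1 := by
  have h := Literature.Probability.RandomPlanarGeometry.intervalIntegrable_betaKernel_one
    (α := 1 - q) (β := p) (by linarith) hp
  simp only [neg_sub] at h
  exact h

/-- `Γ(s + k) = θ^{(k)}·Γ(s)` with `θ^{(k)} = ∏_{j<k}(s+j)` (`s > 0`). -/
theorem gamma_shift (s : ℝ) (hs : 0 < s) (k : ℕ) :
    Real.Gamma (s + k) = (∏ j ∈ range k, (s + j)) * Real.Gamma s := by
  induction k with
  | zero => simp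
  | succ k ih =>
    rw [prod_range_succ, Nat.cast_succ, ← add_assoc, Real.Gamma_add_one (by positivity), ih]
    ring

/-- Interval integrals over `[0,1]` only see the open interval. -/
theorem integral_congr_Ioo {f g : ℝ → ℝ} (hfg : EqOn f g (Ioo 0 1)) :
    ∫ u in (0 : ℝ)..1, f u = ∫ u in (0 : ℝ)..1, g u := by
  rw [intervalIntegral.integral_of_le zero_le_one, intervalIntegral.integral_of_le zero_le_one,
    integral_Ioc_eq_integral_Ioo, integral_Ioc_eq_integral_Ioo]
  exact setIntegral_congr_fun measurableSet_Ioo hfg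

/-- An interval integral over `[0,1]` of a function nonnegative on `(0,1)` is nonnegative. -/
theorem integral_nonneg_Ioo {f : ℝ → ℝ} (hf : ∀ u ∈ Ioo (0 : ℝ) 1, 0 ≤ f u) :
    0 ≤ ∫ u in (0 : ℝ)..1, f u := by
  rw [intervalIntegral.integral_of_le zero_le_one, integral_Ioc_eq_integral_Ioo]
  exact setIntegral_nonneg measurableSet_Ioo hf

/-- On `(0,1)` the symmetrised moment kernel is a sum of two Beta kernels:
`u^{θ-1}(1-u)^{θ-1}[u^n(1-u)^{h-n} + (1-u)^n u^{h-n}] = u^{θ+n-1}(1-u)^{θ+(h-n)-1} + u^{θ+(h-n)-1}(1-u)^{θ+n-1}`. -/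
theorem kernel_eqOn (θ : ℝ) (h n : ℕ) :
    EqOn (fun u : ℝ => u ^ (θ - 1) * (1 - u) ^ (θ - 1) * (u ^ n * (1 - u) ^ (h - n) + (1 - u) ^ n * u ^ (h - n)))
      (fun u : ℝ => u ^ (θ + n - 1) * (1 - u) ^ (θ + ((h - n : ℕ) : ℝ) - 1) +
        u ^ (θ + ((h - n : ℕ) : ℝ) - 1) * (1 - u) ^ (θ + n - 1)) (Ioo 0 1) := by
  intro u hu
  have h0 : 0 < u := hu.1
  have h1 : 0 < 1 - u := by linarith [hu.2]
  simp only
  rw [show θ + n - 1 = (θ - 1) + (n : ℝ) by ring,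
    show θ + ((h - n : ℕ) : ℝ) - 1 = (θ - 1) + ((h - n : ℕ) : ℝ) by ring,
    Real.rpow_add h0, Real.rpow_add h1, Real.rpow_add h0, Real.rpow_add h1,
    Real.rpow_natCast, Real.rpow_natCast, Real.rpow_natCast, Real.rpow_natCast]
  ring

/-- The symmetrised moment kernel is integrable on `[0,1]` (`θ > 0`). -/
theorem kernel_integrable (θ : ℝ) (hθ : 0 < θ) (h n : ℕ) :
    IntervalIntegrable
      (fun u : ℝ => u ^ (θ - 1) * (1 - u) ^ (θ - 1) * (u ^ n * (1 - u) ^ (h - n) + (1 - u) ^ n * u ^ (h - n)))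
      volume 0 1 := by
  have hp : 0 < θ + n := by positivity
  have hq : 0 < θ + ((h - n : ℕ) : ℝ) := by positivity
  have hsum := (beta_integrable _ _ hp hq).add (beta_integrable _ _ hq hp)
  refine hsum.congr_uIoo ?_
  rw [uIoo_of_le zero_le_one]
  exact (kernel_eqOn θ h n).symm

/-- **Moment identity.**  For `θ > 0` and `m ≤ h`:
`∫₀¹ u^{θ-1}(1-u)^{θ-1}[u^m(1-u)^{h-m} + (1-u)^m u^{h-m}] du = 2Γ(θ)²/Γ(2θ+h) · θ^{(m)} θ^{(h-m)}`. -/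
theorem moment (θ : ℝ) (hθ : 0 < θ) (h m : ℕ) (hm : m ≤ h) :
    ∫ u in (0 : ℝ)..1,
        u ^ (θ - 1) * (1 - u) ^ (θ - 1) * (u ^ m * (1 - u) ^ (h - m) + (1 - u) ^ m * u ^ (h - m)) =
      2 * Real.Gamma θ ^ 2 / Real.Gamma (2 * θ + h) *
        ((∏ k ∈ range m, (θ + k)) * ∏ k ∈ range (h - m), (θ + k)) := by
  have hp : 0 < θ + m := by positivity
  have hq : 0 < θ + ((h - m : ℕ) : ℝ) := by positivity
  have hpq : θ + m + (θ + ((h - m : ℕ) : ℝ)) = 2 * θ + h := by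
    rw [Nat.cast_sub hm]; ring
  have hqp : θ + ((h - m : ℕ) : ℝ) + (θ + m) = 2 * θ + h := by
    rw [Nat.cast_sub hm]; ring
  rw [integral_congr_Ioo (kernel_eqOn θ h m),
    intervalIntegral.integral_add (beta_integrable _ _ hp hq) (beta_integrable _ _ hq hp),
    beta_real _ _ hp hq, beta_real _ _ hq hp, hpq, hqp, gamma_shift θ hθ m, gamma_shift θ hθ (h - m)]
  ring

/-- `u^n(1-u)^{h-n} = (1-u)^h ρ^n` with `ρ = u/(1-u)` (`u ∈ (0,1)`, `n ≤ h`). -/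
theorem pow_to_rho (u : ℝ) (hu : u ∈ Ioo (0 : ℝ) 1) (h n : ℕ) (hn : n ≤ h) :
    u ^ n * (1 - u) ^ (h - n) = (1 - u) ^ h * (u / (1 - u)) ^ n := by
  have h1 : 0 < 1 - u := by linarith [hu.2]
  have hsplit : (1 - u) ^ h = (1 - u) ^ n * (1 - u) ^ (h - n) := by
    rw [← pow_add, Nat.add_sub_cancel' hn]
  rw [div_pow, hsplit]
  field_simp

/-- `(1-u)^n u^{h-n} = (1-u)^h ρ^{h-n}` with `ρ = u/(1-u)` (`u ∈ (0,1)`, `n ≤ h`). -/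
theorem pow_to_rho' (u : ℝ) (hu : u ∈ Ioo (0 : ℝ) 1) (h n : ℕ) (hn : n ≤ h) :
    (1 - u) ^ n * u ^ (h - n) = (1 - u) ^ h * (u / (1 - u)) ^ (h - n) := by
  have h1 : 0 < 1 - u := by linarith [hu.2]
  have hsplit : (1 - u) ^ h = (1 - u) ^ (h - n) * (1 - u) ^ n := by
    rw [← pow_add, Nat.sub_add_cancel hn]
  rw [div_pow, hsplit]
  field_simp

/-- **The analytic step (Beta mixture).**  If `0 ≤ ∑_i E_i (ρ^{m_i} + ρ^{h-m_i})` for every `ρ > 0`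
(`m_i ≤ h`), then `0 ≤ ∑_i E_i θ^{(m_i)} θ^{(h-m_i)}` for every real `θ > 0`
(`θ^{(m)} = ∏_{k<m} (θ+k)`): the rising-factorial kernel is a positive mixture (Beta(θ,θ) weight,
symmetrised under `u ↔ 1-u`) of the biased kernels. -/
theorem beta_mixture {ι : Type*} (s : Finset ι) (E : ι → ℝ) (m : ι → ℕ) (h : ℕ)
    (hm : ∀ i ∈ s, m i ≤ h) (θ : ℝ) (hθ : 0 < θ)
    (hpos : ∀ ρ : ℝ, 0 < ρ → 0 ≤ ∑ i ∈ s, E i * (ρ ^ (m i) + ρ ^ (h - m i))) :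
    0 ≤ ∑ i ∈ s, E i * ((∏ k ∈ range (m i), (θ + k)) * ∏ k ∈ range (h - m i), (θ + k)) := by
  have hG : 0 < Real.Gamma θ := Real.Gamma_pos_of_pos hθ
  have hG2 : 0 < Real.Gamma (2 * θ + h) := Real.Gamma_pos_of_pos (by positivity)
  -- the symmetrised moment kernel
  set W : ℕ → ℝ → ℝ := fun n u =>
    u ^ (θ - 1) * (1 - u) ^ (θ - 1) * (u ^ n * (1 - u) ^ (h - n) + (1 - u) ^ n * u ^ (h - n)) with hW
  set Kc : ℝ := Real.Gamma (2 * θ + h) / (2 * Real.Gamma θ ^ 2) with hKc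
  have hKc_pos : 0 < Kc := by positivity
  have key : ∀ i ∈ s, (∏ k ∈ range (m i), (θ + k)) * ∏ k ∈ range (h - m i), (θ + k) =
      Kc * ∫ u in (0 : ℝ)..1, W (m i) u := by
    intro i hi
    rw [hW, moment θ hθ h (m i) (hm i hi), hKc]
    field_simp
  have hint : ∀ i ∈ s, IntervalIntegrable (fun u : ℝ => E i * W (m i) u) volume 0 1 := by
    intro i hi
    exact (kernel_integrable θ hθ h (m i)).const_mul (E i)
  have step : ∑ i ∈ s, E i * ((∏ k ∈ range (m i), (θ + k)) * ∏ k ∈ range (h - m i), (θ + k)) =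
      Kc * ∫ u in (0 : ℝ)..1, ∑ i ∈ s, E i * W (m i) u := by
    rw [intervalIntegral.integral_finsetSum hint, mul_sum]
    refine sum_congr rfl fun i hi => ?_
    rw [key i hi, intervalIntegral.integral_const_mul]
    ring
  rw [step]
  refine mul_nonneg hKc_pos.le (integral_nonneg_Ioo fun u hu => ?_)
  have h0 : 0 < u := hu.1
  have h1 : 0 < 1 - u := by linarith [hu.2]
  have hρ : 0 < u / (1 - u) := div_pos h0 h1
  have hw : 0 ≤ u ^ (θ - 1) * (1 - u) ^ (θ - 1) * (1 - u) ^ h :=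
    mul_nonneg (mul_nonneg (Real.rpow_nonneg h0.le _) (Real.rpow_nonneg h1.le _)) (pow_nonneg h1.le _)
  have expand : ∀ i ∈ s, E i * W (m i) u =
      (u ^ (θ - 1) * (1 - u) ^ (θ - 1) * (1 - u) ^ h) *
        (E i * ((u / (1 - u)) ^ (m i) + (u / (1 - u)) ^ (h - m i))) := by
    intro i hi
    rw [hW]
    simp only
    rw [pow_to_rho u hu h (m i) (hm i hi), pow_to_rho' u hu h (m i) (hm i hi)]
    ring
  rw [sum_congr rfl expand, ← mul_sum]
  exact mul_nonneg hw (hpos _ hρ)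

/-- **(Ω₁) for every real rate `θ > 0`** (OMEGA1-g27 §0–§1; = CONJECTURE Ω of OMEGA-g25 §3.2 for the
deterministic single-token law).  For block sizes `h_b + u_b = 2m_b - 1` (`m₁ = a+1`, `m₂ = c+1`),
`h₁ + h₂ ≥ 2`, and the rising-factorial kernel `F_θ(i) = C(h₁+h₂-2, i-1)·θ^{(i)}θ^{(h₁+h₂-i)}`
(`0` for `i = 0`; `θ^{(i)} = ∏_{k<i}(θ+k)`):
`(a+c)·S_θ(a+1,c) ≤ (a+c+1)·S_θ(a+1,c+1)`. -/
theorem omega_one (a c h₁ u₁ h₂ u₂ : ℕ) (hn₁ : h₁ + u₁ = 2 * a + 1) (hn₂ : h₂ + u₂ = 2 * c + 1)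
    (hh : 2 ≤ h₁ + h₂) (θ : ℝ) (hθ : 0 < θ) :
    ((a : ℝ) + c) * ∑ i ∈ range (h₁ + 1), ∑ j ∈ range (h₂ + 1),
        (h₁.choose i : ℝ) * (if i ≤ a + 1 then (u₁.choose (a + 1 - i) : ℝ) else 0) *
          ((h₂.choose j : ℝ) * (if j ≤ c then (u₂.choose (c - j) : ℝ) else 0)) *
          ((if 1 ≤ i + j then ((h₁ + h₂ - 2).choose (i + j - 1) : ℝ) else 0) *
            ((∏ k ∈ range (i + j), (θ + k)) * ∏ k ∈ range (h₁ + h₂ - (i + j)), (θ + k))) ≤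
    ((a : ℝ) + c + 1) * ∑ i ∈ range (h₁ + 1), ∑ j ∈ range (h₂ + 1),
        (h₁.choose i : ℝ) * (if i ≤ a + 1 then (u₁.choose (a + 1 - i) : ℝ) else 0) *
          ((h₂.choose j : ℝ) * (if j ≤ c + 1 then (u₂.choose (c + 1 - j) : ℝ) else 0)) *
          ((if 1 ≤ i + j then ((h₁ + h₂ - 2).choose (i + j - 1) : ℝ) else 0) *
            ((∏ k ∈ range (i + j), (θ + k)) * ∏ k ∈ range (h₁ + h₂ - (i + j)), (θ + k))) := by
  -- the signed coefficient of the kernel value at `i+j`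
  set E : ℕ × ℕ → ℝ := fun p =>
    (((a : ℝ) + c + 1) * ((h₁.choose p.1 : ℝ) * (if p.1 ≤ a + 1 then (u₁.choose (a + 1 - p.1) : ℝ) else 0) *
        ((h₂.choose p.2 : ℝ) * (if p.2 ≤ c + 1 then (u₂.choose (c + 1 - p.2) : ℝ) else 0))) -
      ((a : ℝ) + c) * ((h₁.choose p.1 : ℝ) * (if p.1 ≤ a + 1 then (u₁.choose (a + 1 - p.1) : ℝ) else 0) *
        ((h₂.choose p.2 : ℝ) * (if p.2 ≤ c then (u₂.choose (c - p.2) : ℝ) else 0)))) *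
      (if 1 ≤ p.1 + p.2 then ((h₁ + h₂ - 2).choose (p.1 + p.2 - 1) : ℝ) else 0) with hE
  -- rearrangement, for an arbitrary kernel value `Φ(i+j)`
  have rearr : ∀ Φ : ℕ → ℝ,
      ((a : ℝ) + c + 1) * ∑ i ∈ range (h₁ + 1), ∑ j ∈ range (h₂ + 1),
          (h₁.choose i : ℝ) * (if i ≤ a + 1 then (u₁.choose (a + 1 - i) : ℝ) else 0) *
            ((h₂.choose j : ℝ) * (if j ≤ c + 1 then (u₂.choose (c + 1 - j) : ℝ) else 0)) *
            ((if 1 ≤ i + j then ((h₁ + h₂ - 2).choose (i + j - 1) : ℝ) else 0) * Φ (i + j)) -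
      ((a : ℝ) + c) * ∑ i ∈ range (h₁ + 1), ∑ j ∈ range (h₂ + 1),
          (h₁.choose i : ℝ) * (if i ≤ a + 1 then (u₁.choose (a + 1 - i) : ℝ) else 0) *
            ((h₂.choose j : ℝ) * (if j ≤ c then (u₂.choose (c - j) : ℝ) else 0)) *
            ((if 1 ≤ i + j then ((h₁ + h₂ - 2).choose (i + j - 1) : ℝ) else 0) * Φ (i + j)) =
      ∑ p ∈ range (h₁ + 1) ×ˢ range (h₂ + 1), E p * Φ (p.1 + p.2) := by
    intro Φ
    rw [sum_product, mul_sum, mul_sum, ← sum_sub_distrib]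
    refine sum_congr rfl fun i _ => ?_
    rw [mul_sum, mul_sum, ← sum_sub_distrib]
    refine sum_congr rfl fun j _ => ?_
    rw [hE]
    ring
  have hm : ∀ p ∈ range (h₁ + 1) ×ˢ range (h₂ + 1), p.1 + p.2 ≤ h₁ + h₂ := by
    intro p hp
    rw [Finset.mem_product, Finset.mem_range, Finset.mem_range] at hp
    omega
  have hposρ : ∀ ρ : ℝ, 0 < ρ →
      0 ≤ ∑ p ∈ range (h₁ + 1) ×ˢ range (h₂ + 1), E p * (ρ ^ (p.1 + p.2) + ρ ^ (h₁ + h₂ - (p.1 + p.2))) := by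
    intro ρ hρ
    have hc := CoreT.core_t a c h₁ u₁ h₂ u₂ hn₁ hn₂ hh ρ hρ
    rw [← rearr (fun n => ρ ^ n + ρ ^ (h₁ + h₂ - n))]
    exact sub_nonneg.mpr hc
  have main := beta_mixture (range (h₁ + 1) ×ˢ range (h₂ + 1)) E (fun p => p.1 + p.2) (h₁ + h₂) hm θ hθ hposρ
  rw [← rearr (fun n => (∏ k ∈ range n, (θ + k)) * ∏ k ∈ range (h₁ + h₂ - n), (θ + k))] at main
  exact sub_nonneg.mp main

end OmegaOne

end Summit.CriticalPhenomena.PercolationContinuityZ3.Theorems
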